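import Summits.CriticalPhenomena.PercolationContinuityZ3.Theorems.PercThresholdOneFragileWeavingGiantExistsPattern

/-!
# `FragileWeavingGiantExists` (stmt-CriticalPhenomena-5266) — exit types, jump levels and the parent step

Part of the proof of support item `FragileWeavingGiantExists` of route `PercThresholdOne` by the stationary
hierarchical spanning tree of `ℤ³` (see `PercThresholdOneFragileWeavingGiantExistsDefs.lean` for the construction and the overview).
-/

noncomputable section

namespace Summit.CriticalPhenomena.PercolationContinuityZ3.Theorems.FragileGiant

open MeasureTheory
open scoped ENNReal
open Literature.Probability.Percolation Literature.Probability.LatticeModels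
open Literature.Probability.Percolation.DCT16

/-- On the good event every site has synchronising digits above every level. -/
theorem exists_sync (ω : Ω) (hω : ω ∈ goodSet) (x : V3) (m : ℕ) :
    ∃ j, isSync (digit ω x (m + j)) = true := by
  obtain ⟨n, hn, h⟩ := hω x b0 m
  refine ⟨n - m, ?_⟩
  rw [Nat.add_sub_cancel' hn, h]
  exact isSync_b0

/-- **The recursion** `X_m = nextType(a_m, X_{m+1})`. -/
theorem exitType_rec (ω : Ω) (hω : ω ∈ goodSet) (x : V3) (m : ℕ) :
    exitType ω x m = nextType (digit ω x m) (exitType ω x (m + 1)) := by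
  have h0 := exists_sync ω hω x m
  have h1 := exists_sync ω hω x (m + 1)
  by_cases hs : isSync (digit ω x m) = true
  · have hl : syncLevel ω x m = 0 := by
      rw [syncLevel, dif_pos h0, Nat.find_eq_zero]; simpa using hs
    rw [exitType, hl, exitTypeAux, nextType_of_isSync _ hs]
  · have hl : syncLevel ω x m = syncLevel ω x (m + 1) + 1 := by
      rw [syncLevel, dif_pos h0, syncLevel, dif_pos h1, Nat.find_eq_iff]
      refine ⟨?_, fun j hj => ?_⟩
      · have := Nat.find_spec h1
        rwa [show m + (Nat.find h1 + 1) = m + 1 + Nat.find h1 by ring]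
      · rcases j with _ | j
        · simpa using hs
        · have := Nat.find_min h1 (show j < Nat.find h1 by omega)
          rwa [show m + (j + 1) = m + 1 + j by ring]
    rw [exitType, hl, exitTypeAux, exitType]

/-- Block invariance of the exit types: points of a common `n`-block have the same exit types at all
levels `≥ n`. -/
theorem exitType_eq_of_mem_blk (ω : Ω) {n : ℕ} {x y : V3} (h : y ∈ blk ω n x) {m : ℕ} (hm : n ≤ m) :
    exitType ω y m = exitType ω x m := by
  have hd : ∀ m', n ≤ m' → digit ω y m' = digit ω x m' := fun m' h' => digit_eq_of_mem_blk ω h h'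
  have haux : ∀ j m', n ≤ m' → exitTypeAux ω y m' j = exitTypeAux ω x m' j := by
    intro j
    induction j with
    | zero => intro m' h'; simp [exitTypeAux, hd m' h']
    | succ j ih => intro m' h'; simp [exitTypeAux, hd m' h', ih (m' + 1) (by omega)]
  have h' : ∀ j, digit ω y (m + j) = digit ω x (m + j) := fun j => hd (m + j) (by omega)
  have hiff : (∃ j, isSync (digit ω y (m + j)) = true) ↔ ∃ j, isSync (digit ω x (m + j)) = true := by
    simp only [h']
  have hl : syncLevel ω y m = syncLevel ω x m := by
    unfold syncLevel
    by_cases hy : ∃ j, isSync (digit ω y (m + j)) = true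
    · rw [dif_pos hy, dif_pos (hiff.1 hy)]
      apply le_antisymm
      · exact Nat.find_min' hy (by rw [h']; exact Nat.find_spec (hiff.1 hy))
      · exact Nat.find_min' _ (by rw [← h']; exact Nat.find_spec hy)
    · rw [dif_neg hy, dif_neg (mt hiff.2 hy)]
  rw [exitType, exitType, hl, haux _ _ hm]

/-- On the good event the jump level is well defined. -/
theorem exists_jump (ω : Ω) (hω : ω ∈ goodSet) (x : V3) :
    ∃ m, digit ω x m ≠ pos (exitType ω x (m + 1)) := by
  obtain ⟨m, -, h⟩ := hω x b0 0
  exact ⟨m, by rw [h]; exact b0_ne_pos _⟩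

/-- At the jump level the block of `x` is not the exit-corner sub-block. -/
theorem digit_jlev_ne (ω : Ω) (hω : ω ∈ goodSet) (x : V3) :
    digit ω x (jlev ω x) ≠ pos (exitType ω x (jlev ω x + 1)) := by
  rw [jlev, dif_pos (exists_jump ω hω x)]
  exact Nat.find_spec (exists_jump ω hω x)

/-- Below the jump level the blocks of `x` are exit-corner sub-blocks. -/
theorem digit_eq_pos_of_lt_jlev (ω : Ω) (hω : ω ∈ goodSet) (x : V3) {m : ℕ} (hm : m < jlev ω x) :
    digit ω x m = pos (exitType ω x (m + 1)) := by
  rw [jlev, dif_pos (exists_jump ω hω x)] at hm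
  have := Nat.find_min (exists_jump ω hω x) hm
  push Not at this
  exact this

/-- Below the jump level the exit type is constant. -/
theorem exitType_eq_of_le_jlev (ω : Ω) (hω : ω ∈ goodSet) (x : V3) {m : ℕ} (hm : m ≤ jlev ω x) :
    exitType ω x m = exitType ω x (jlev ω x) := by
  obtain ⟨d, hd⟩ := Nat.exists_eq_add_of_le hm
  induction d generalizing m with
  | zero => rw [hd]; rfl
  | succ d ih =>
    have hm' : m < jlev ω x := by omega
    rw [exitType_rec ω hω x m, digit_eq_pos_of_lt_jlev ω hω x hm', nextType_pos]
    exact ih (by omega) (by omega)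

/-- Below the jump level all digits equal the corner position of the exit type at the jump level. -/
theorem digit_eq_pos_jlev (ω : Ω) (hω : ω ∈ goodSet) (x : V3) {m : ℕ} (hm : m < jlev ω x) :
    digit ω x m = pos (exitType ω x (jlev ω x)) := by
  rw [digit_eq_pos_of_lt_jlev ω hω x hm, exitType_eq_of_le_jlev ω hω x hm]

/-- **`x` is the exit corner of its blocks below the jump level**: for `n ≤ jlev x` the relative
position of `x` in `B_n(x)` is `0` in the coordinate `i` with exit type `some i` and `3^n - 1`
in the other coordinates. -/
theorem rel_of_le_jlev (ω : Ω) (hω : ω ∈ goodSet) (x : V3) {n : ℕ} (hn : n ≤ jlev ω x) (i : Fin 3) :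
    rel ω n x i = if exitType ω x (jlev ω x) = some i then 0 else 3 ^ n - 1 := by
  induction n with
  | zero => simp [rel]
  | succ n ih =>
    rw [rel_succ, ih (Nat.le_of_succ_le hn), digit_eq_pos_jlev ω hω x hn, pos_apply]
    split_ifs <;> simp [pow_succ]; ring

/-- If `rel_n(x)_i = 0` then all digits of `x` below level `n` vanish in coordinate `i`. -/
theorem digit_eq_zero_of_rel_eq_zero (ω : Ω) {n : ℕ} {x : V3} {i : Fin 3} (h : rel ω n x i = 0) {m : ℕ}
    (hm : m < n) : digit ω x m i = 0 := by
  by_contra hd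
  have := pow_le_rel_of_digit_ne_zero ω hm x i hd
  linarith [three_pow_pos m]

/-- If `rel_n(x)_i = 3^n - 1` then all digits of `x` below level `n` equal `2` in coordinate `i`. -/
theorem digit_eq_two_of_rel_eq (ω : Ω) {n : ℕ} {x : V3} {i : Fin 3} (h : rel ω n x i = 3 ^ n - 1) {m : ℕ}
    (hm : m < n) : digit ω x m i = 2 := by
  by_contra hd
  have := rel_add_pow_le_of_digit_ne_two ω hm x i hd
  linarith [three_pow_pos m]

/-- The parent edge is a lattice edge of `ℤ³`. -/
theorem par_adj (ω : Ω) (u : V3) : (zdGraph 3).Adj u (par ω u) := by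
  rw [zdGraph_adj_iff]
  refine ⟨(parDir ω u).1, ?_⟩
  unfold par unitVec
  split_ifs
  · exact Or.inl rfl
  · exact Or.inr (by simp)

/-- The parent edge belongs to the edge set of `ℤ³`. -/
theorem mk_par_mem_edgeSet (ω : Ω) (u : V3) : s(u, par ω u) ∈ (zdGraph 3).edgeSet :=
  (SimpleGraph.mem_edgeSet _).2 (par_adj ω u)

/-- The parent differs from the point. -/
theorem par_ne (ω : Ω) (u : V3) : par ω u ≠ u := fun h => (par_adj ω u).ne h.symm

/-- The exit type at the jump level is the corner of the parent direction. -/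
theorem exitType_jlev (ω : Ω) (hω : ω ∈ goodSet) (u : V3) :
    exitType ω u (jlev ω u) = cornerOf (parDir ω u) := by
  rw [exitType_rec ω hω u, nextType_of_ne (digit_jlev_ne ω hω u)]; rfl

/-- The parent direction is valid at the jump digit. -/
theorem valid_parDir (ω : Ω) (hω : ω ∈ goodSet) (u : V3) :
    valid (digit ω u (jlev ω u)) (parDir ω u) = true :=
  qstep_valid _ _ (digit_jlev_ne ω hω u)

/-- **The parent step, positive case.** If the parent direction is `+eᵢ`: the parent lies in the
`(jlev+1)`-block, its jump-level digit is the routing successor, and below the jump level it sits at the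
corner position `pos (some i)`. -/
theorem par_spec_pos (ω : Ω) (hω : ω ∈ goodSet) (u : V3) {i : Fin 3} (hd : parDir ω u = (i, true)) :
    par ω u ∈ blk ω (jlev ω u + 1) u ∧
    digit ω (par ω u) (jlev ω u) = qnext (digit ω u (jlev ω u)) (exitType ω u (jlev ω u + 1)) ∧
    ∀ m < jlev ω u, digit ω (par ω u) m = pos (some i) := by
  have hpar : par ω u = u + Pi.single i 1 := by simp [par, unitVec, hd]
  have hX : exitType ω u (jlev ω u) = none := by rw [exitType_jlev ω hω u, hd]; rfl
  have hrelj : ∀ i', rel ω (jlev ω u) u i' = 3 ^ jlev ω u - 1 := fun i' => by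
    rw [rel_of_le_jlev ω hω u le_rfl, hX]; simp
  have hval := valid_parDir ω hω u
  rw [hd, valid_iff] at hval
  simp only [ite_true] at hval
  have ha1 : ((digit ω u (jlev ω u) i : ℕ) : ℤ) ≤ 1 := by
    have h3 := (digit ω u (jlev ω u) i).isLt
    have : (digit ω u (jlev ω u) i : ℕ) ≠ 2 := fun h0 => hval (Fin.ext h0)
    omega
  have hrel1 : rel ω (jlev ω u + 1) u i = (((digit ω u (jlev ω u) i : ℕ) : ℤ) + 1) * 3 ^ jlev ω u - 1 := by
    rw [rel_succ, hrelj]; ring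
  have hlt : rel ω (jlev ω u + 1) u i + 1 < 3 ^ (jlev ω u + 1) := by
    rw [hrel1, pow_succ]; nlinarith [three_pow_pos (jlev ω u)]
  obtain ⟨hmem, hri, hrj⟩ := add_single_mem_blk ω hlt
  rw [← hpar] at hmem hri hrj
  -- digits of the parent at the jump level and relative positions below it
  have hi := rel_digit_unique ω (jlev ω u) (par ω u) i (r := 0) (d := ((digit ω u (jlev ω u) i : ℕ) : ℤ) + 1)
    le_rfl (three_pow_pos _) (by rw [hri, hrel1]; ring)
  have hj : ∀ i', i' ≠ i → rel ω (jlev ω u) (par ω u) i' = 3 ^ jlev ω u - 1 ∧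
      ((digit ω (par ω u) (jlev ω u) i' : ℕ) : ℤ) = ((digit ω u (jlev ω u) i' : ℕ) : ℤ) := by
    intro i' hi'
    have := rel_digit_unique ω (jlev ω u) (par ω u) i' (r := 3 ^ jlev ω u - 1)
      (d := ((digit ω u (jlev ω u) i' : ℕ) : ℤ)) (by linarith [three_pow_pos (jlev ω u)]) (by linarith)
      (by rw [hrj i' hi', rel_succ, hrelj])
    exact this
  refine ⟨hmem, ?_, fun m hm => ?_⟩
  · have hmv := movePos_val_of_valid (digit ω u (jlev ω u)) (i, true) (by rw [← hd]; exact valid_parDir ω hω u)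
    simp only [ite_true] at hmv
    show digit ω (par ω u) (jlev ω u) = movePos (digit ω u (jlev ω u)) (parDir ω u)
    rw [hd]
    funext i'
    apply Fin.ext
    rcases eq_or_ne i' i with rfl | hi'
    · have h1 := hi.2; rw [hmv.1]; exact_mod_cast h1
    · rw [hmv.2 i' hi']; exact_mod_cast (hj i' hi').2
  · funext i'
    rw [pos_apply]
    rcases eq_or_ne i' i with rfl | hi'
    · simp only [ite_true]
      exact digit_eq_zero_of_rel_eq_zero ω hi.1 hm
    · rw [if_neg (fun h => hi' (Option.some_injective _ h).symm)]
      exact digit_eq_two_of_rel_eq ω (hj i' hi').1 hm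

/-- **The parent step, negative case.** If the parent direction is `-eᵢ`: the parent lies in the
`(jlev+1)`-block, its jump-level digit is the routing successor, and below the jump level it sits at the
all-max corner position `pos none`. -/
theorem par_spec_neg (ω : Ω) (hω : ω ∈ goodSet) (u : V3) {i : Fin 3} (hd : parDir ω u = (i, false)) :
    par ω u ∈ blk ω (jlev ω u + 1) u ∧
    digit ω (par ω u) (jlev ω u) = qnext (digit ω u (jlev ω u)) (exitType ω u (jlev ω u + 1)) ∧
    ∀ m < jlev ω u, digit ω (par ω u) m = pos none := by
  have hpar : par ω u = u - Pi.single i 1 := by simp [par, unitVec, hd, sub_eq_add_neg]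
  have hX : exitType ω u (jlev ω u) = some i := by rw [exitType_jlev ω hω u, hd]; rfl
  have hreli : rel ω (jlev ω u) u i = 0 := by
    rw [rel_of_le_jlev ω hω u le_rfl, hX]; simp
  have hrelj' : ∀ i', i' ≠ i → rel ω (jlev ω u) u i' = 3 ^ jlev ω u - 1 := fun i' hi' => by
    rw [rel_of_le_jlev ω hω u le_rfl, hX, if_neg (fun h => hi' (Option.some_injective _ h).symm)]
  have hval := valid_parDir ω hω u
  rw [hd, valid_iff] at hval
  simp only [Bool.false_eq_true, ite_false] at hval
  have ha1 : (1 : ℤ) ≤ ((digit ω u (jlev ω u) i : ℕ) : ℤ) := by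
    have : (digit ω u (jlev ω u) i : ℕ) ≠ 0 := fun h0 => hval (Fin.ext h0)
    omega
  have hrel1 : rel ω (jlev ω u + 1) u i = ((digit ω u (jlev ω u) i : ℕ) : ℤ) * 3 ^ jlev ω u := by
    rw [rel_succ, hreli]; ring
  have hge : 1 ≤ rel ω (jlev ω u + 1) u i := by
    rw [hrel1]; nlinarith [three_pow_pos (jlev ω u)]
  obtain ⟨hmem, hri, hrj⟩ := sub_single_mem_blk ω hge
  rw [← hpar] at hmem hri hrj
  have hi := rel_digit_unique ω (jlev ω u) (par ω u) i (r := 3 ^ jlev ω u - 1)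
    (d := ((digit ω u (jlev ω u) i : ℕ) : ℤ) - 1) (by linarith [three_pow_pos (jlev ω u)]) (by linarith)
    (by rw [hri, hrel1]; ring)
  have hj : ∀ i', i' ≠ i → rel ω (jlev ω u) (par ω u) i' = 3 ^ jlev ω u - 1 ∧
      ((digit ω (par ω u) (jlev ω u) i' : ℕ) : ℤ) = ((digit ω u (jlev ω u) i' : ℕ) : ℤ) := by
    intro i' hi'
    exact rel_digit_unique ω (jlev ω u) (par ω u) i' (r := 3 ^ jlev ω u - 1)
      (d := ((digit ω u (jlev ω u) i' : ℕ) : ℤ)) (by linarith [three_pow_pos (jlev ω u)]) (by linarith)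
      (by rw [hrj i' hi', rel_succ, hrelj' i' hi'])
  refine ⟨hmem, ?_, fun m hm => ?_⟩
  · have hmv := movePos_val_of_valid (digit ω u (jlev ω u)) (i, false) (by rw [← hd]; exact valid_parDir ω hω u)
    simp only [Bool.false_eq_true, ite_false] at hmv
    show digit ω (par ω u) (jlev ω u) = movePos (digit ω u (jlev ω u)) (parDir ω u)
    rw [hd]
    funext i'
    apply Fin.ext
    rcases eq_or_ne i' i with rfl | hi'
    · have h1 := hi.2; rw [hmv.1]; omega
    · rw [hmv.2 i' hi']; exact_mod_cast (hj i' hi').2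
  · funext i'
    rw [pos_apply, if_neg (Option.some_ne_none i').symm]
    rcases eq_or_ne i' i with rfl | hi'
    · exact digit_eq_two_of_rel_eq ω hi.1 hm
    · exact digit_eq_two_of_rel_eq ω (hj i' hi').1 hm

/-- **The parent step (summary).** -/
theorem par_spec (ω : Ω) (hω : ω ∈ goodSet) (u : V3) :
    par ω u ∈ blk ω (jlev ω u + 1) u ∧
    digit ω (par ω u) (jlev ω u) = qnext (digit ω u (jlev ω u)) (exitType ω u (jlev ω u + 1)) ∧
    ∃ t : K4, ∀ m < jlev ω u, digit ω (par ω u) m = pos t := by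
  rcases hd : parDir ω u with ⟨i, _ | _⟩
  · obtain ⟨h1, h2, h3⟩ := par_spec_neg ω hω u hd; exact ⟨h1, h2, none, h3⟩
  · obtain ⟨h1, h2, h3⟩ := par_spec_pos ω hω u hd; exact ⟨h1, h2, some i, h3⟩

/-- The parent lies in the `(jlev + 1)`-block. -/
theorem par_mem_blk (ω : Ω) (hω : ω ∈ goodSet) (u : V3) : par ω u ∈ blk ω (jlev ω u + 1) u :=
  (par_spec ω hω u).1

/-- The parent lies in every block of level above the jump level. -/
theorem par_mem_blk_of_lt (ω : Ω) (hω : ω ∈ goodSet) (u : V3) {n : ℕ} (hn : jlev ω u < n) :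
    par ω u ∈ blk ω n u :=
  blk_mono ω hn u (par_mem_blk ω hω u)

/-- Digits of the parent above the jump level agree with those of the point. -/
theorem digit_par_of_lt (ω : Ω) (hω : ω ∈ goodSet) (u : V3) {m : ℕ} (hm : jlev ω u < m) :
    digit ω (par ω u) m = digit ω u m :=
  digit_eq_of_mem_blk ω (par_mem_blk ω hω u) hm

/-- Exit types of the parent above the jump level agree with those of the point. -/
theorem exitType_par_of_lt (ω : Ω) (hω : ω ∈ goodSet) (u : V3) {m : ℕ} (hm : jlev ω u < m) :
    exitType ω (par ω u) m = exitType ω u m :=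
  exitType_eq_of_mem_blk ω (par_mem_blk ω hω u) hm

end Summit.CriticalPhenomena.PercolationContinuityZ3.Theorems.FragileGiant
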